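import Summits.BirchSwinnertonDyer.BirchSwinnertonDyer.Theorems.CMKolyvaginAtInertTwoExactTwinTamagawaAtTwo
import Summits.BirchSwinnertonDyer.BirchSwinnertonDyer.Theorems.CMKolyvaginAtInertTwoCMExactDescentAtTwo
import Summits.BirchSwinnertonDyer.BirchSwinnertonDyer.Theorems.CMKolyvaginAtInertTwoCMPrimitiveSupplyAtInertTwoOfKolyvaginConjecture
import HarnessLib

/-!
# Route `CMKolyvaginAtInertTwo` (leaf `WAllCornerFTwo`, habitat H₂): THE CERTIFICATE-LEVEL ONE-BIT CLASS THEOREM FROM PRINT —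
# `BSD₂(E)` for every `E ∈ H₂` over a Heegner field of one-bit genus defect (`Σ ≤ 1`) carrying ANY `2`-primitive Kolyvagin class,
# modulo the route's printed inputs ONLY (GZ, GZK, modularity, Milne, Burungale–Flach, Gross 1991 Prop. 3.7 (2)); and the habitat
# conclusion of the route from KOLYVAGIN'S CONJECTURE AT `2` plus a ONE-BIT TWIST SUPPLY

Seat `bsd-line-cmk2-p1` g22 (cell `bsd-print-cf2`), `--supports stmt-BirchSwinnertonDyer-24277` (helper; closes nothing by name — a class
aside is the pen's call).  THEOREMS ONLY (no definition, no named fact, no `sorry`).  BSD is NOT proved by this: CONDITIONAL class theorems.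

g21's `bsdp_two_of_levelZero_of_sum_defect_le_one_of_printedInputs` booked the LEVEL-ZERO case (`M₀ = 0`: the certificate is `y_K` itself).
THIS FILE removes «level zero»: the exponent `M₀` of `y_K` is arbitrary and the certificate is the crux's own — a square-free product `n`
of Zhang–Kolyvagin primes at `2` that are CM-inert (any `2`-adic index) with a datum `d` and `P(n) ∉ 2E(K[n])` — i.e. exactly what the
route's conjecture crux `CMKolyvaginConjectureAtInertTwo` (24648) supplies.  The composition is: g21's exactness on `Σ ≤ 1`
(`card_primaryComponent_sha_two_baseChange_eq_pow_of_certificate_of_sum_defect_le_one_of_printedInputs`: `#Ш(E_K)(2) = 2^{2M₀}`), the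
twin `E^{(d_K)}` of analytic rank `0` (Gross–Zagier: `y_K` non-torsion ⟹ `L(E^{(d_K)},1) ≠ 0`; `CMSupply.exists_minimal_twin_hasCM_
analyticRank_zero`) with `BSD₂` by Burungale–Flach (`Rank1Residual.bsdp_cm_rankZero`), and g0's exact descent
(`CMExactDescent.cmExactDescentAtTwo_of_facts`, item 22837 mod prints).

* **`bsdp_two_of_certificate_of_sum_defect_le_one_of_printedInputs`** — `W ∈ H₂`, `K` with odd `d_K ≠ −3`, Heegner, `Σ ≤ 1`; an odd-Manin
  frame `(Dt, β, ι, d₁)` with `y_K` of infinite order and `2^{M₀} ∥ y_K` in `E(K[1])`; a certificate `(n, d)`: the six prints ⟹ `BSDp W 2`.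
* `bsdp_two_of_certificate_of_twin_tamagawa_of_printedInputs` (one-bit condition in Tamagawa currency «`¬ 4 ∣ ∏ c(Wd')`»),
  `bsdp_two_of_certificate_of_prime_of_printedInputs` (`|d_K|` prime: `Σ = 1` by g15's Jacobi argument).
* **`bsdp_two_of_exists_certificate_of_sum_defect_le_one_of_printedInputs`** — the same WITHOUT the exponent binders: `y_K` of infinite
  order and `∃ (n, d)` primitive suffice (`M₀` exists by Mordell–Weil over `K[1]`).  This is the bookable shape: «BSD₂ for every `E ∈ H₂`
  whose Kolyvagin system over some one-bit Heegner field is `2`-primitive at some level».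
* **`bsdp_two_of_kolyvaginConjecture_of_oneBit_twist_of_printedInputs`** — the route's conjecture crux 24648 (by name) + a one-bit Heegner
  field `K` with `L(E^{(d_K)}, 1) ≠ 0` ⟹ `BSDp W 2` for the member `W` (frame built as in `CMSupply`: Heegner `β`, Darmon 3.6 datum).
* **`bsdp_two_onHabitat_of_kolyvaginConjecture_of_oneBitSupply_of_printedInputs`** — the HABITAT CONCLUSION of `closes`: 24648 + a
  ONE-BIT TWIST SUPPLY («every `E ∈ H₂` has an odd Heegner `d_K ≠ −3` with `Σ ≤ 1` and `L(E^{(d_K)},1) ≠ 0») + Gross 3.7 (2) + the five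
  prints ⟹ `BSDp W 2` for every `W ∈ H₂` with an optimal odd-Manin parametrisation.  This is the kernel form of g21's sentence «after
  the restatement R1′ the route's research content is exactly (A) Kolyvagin's conjecture at `2` and (B) the `Σ = 1` supply print»:
  the exactness crux 24277 and the descent 22837 no longer appear.

HONEST FRAMING: conditional on the same SIX statement-only prints as g21's level-zero theorem; the new hypotheses (certificate /
24648 / one-bit supply) are displayed, not proved.  No printed counterpart of the statement at an inert `2` (barrier
`CMRankOneAtNonsplitTwo`); W. Zhang's «Kolyvagin conjecture ⟹ `p`-part of BSD» (Camb. J. Math. 2014, Thm. 1.1/10.2) is `p ≥ 5`, ordinary,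
non-CM.  BSD is NOT proved by this; no summit statement and no item is closed by this file.

References: [McCallumLMS1991] §5 Thm. 5.4; [Kolyvagin1991MathAnn] Thm. 2.2; [WZhang2014] Thm. 1.1; [GrossLMS1991] §2 (2.2), Prop. 3.7 (2),
§11; [GrossZagier1986] I.6.3, V.§2; [Milne1972ArithmeticAV] Thm. 1; [BurungaleFlach2024] Thm. 1.1, Cor. 2; [Kramer1981] Prop. 3;
[Darmon2004] Thm. 3.6.
-/

set_option autoImplicit false
-- the Theorems namespace of this sub repeats the summit name by design (D-0017 nested layout)
set_option linter.dupNamespace false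

noncomputable section

open scoped Classical

open WeierstrassCurve NumberField Literature.NumberTheory.EllipticCurves
  Literature.NumberTheory.EllipticCurves.ModularForms
  Literature.NumberTheory.EllipticCurves.Rank1Residual
  Literature.NumberTheory.EllipticCurves.Rank1Residual.Typed
  Literature.NumberTheory.EllipticCurves.KrizLi2019
  Summit.BirchSwinnertonDyer.Rank1Residual
open Literature.NumberTheory.EllipticCurves.GrossLMS1991 (prop37_2_reductionCongruence_inert)
open Summit.BirchSwinnertonDyer.BirchSwinnertonDyer.Theorems.CMExactDescent
open Summit.BirchSwinnertonDyer.BirchSwinnertonDyer.Theses.CMKolyvaginAtInertTwo (CMKolyvaginConjectureAtInertTwo)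

namespace Summit.BirchSwinnertonDyer.BirchSwinnertonDyer.Theorems.KolyvaginLowerTwo

/-! ## §1 From a certificate at a given exponent `M₀` -/

/-- **THE CERTIFICATE-LEVEL ONE-BIT CLASS THEOREM.**  `W ∈ H₂` (globally minimal, CM, `2` inert in the CM field, `ρ̄_{E,2}` onto,
`r_an(E) = 1`, odd Tamagawa product); `K` imaginary quadratic, `d_K` odd `≠ −3`, Heegner for `N_E`, genus defect `Σ ≤ 1`; a frame `Dt`
(lattice clause, odd Manin constant), `β`, `ι`, `d₁` with `y_K = P(1)` of infinite order and `2^{M₀} ∥ y_K` in `E(K[1])`; a certificate: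
`n` square-free of Zhang–Kolyvagin primes at `2` that are CM-inert, a level-`n` datum `d`, `P(n) ∉ 2E(K[n])`.  THEN `BSDp W 2`, modulo
GZ (all levels), GZK, modularity, Milne any-model, Burungale–Flach and Gross 1991 Prop. 3.7 (2).  Proof: `#Ш(E_K)(2) = 2^{2M₀}` (g21's
exactness on `Σ ≤ 1`); the twin `E^{(d_K)}` has `L ≠ 0` (Gross–Zagier), a globally minimal CM model of analytic rank `0` with `BSD₂`
(Burungale–Flach); g0's exact descent concludes. [cite: McCallumLMS1991, §5 Thm. 5.4] [cite: GrossZagier1986, V.§2]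
[cite: Milne1972ArithmeticAV, Thm. 1] [cite: BurungaleFlach2024, Thm. 1.1 and Cor. 2] [cite: GrossLMS1991, Prop. 3.7 (2)] -/
theorem bsdp_two_of_certificate_of_sum_defect_le_one_of_printedInputs
    (hGZ : ∀ (N : ℕ) [NeZero N] (W : WeierstrassCurve ℚ) (K : Type) [Field K] [NumberField K], gross_zagier N W K)
    (hGZK : rank_eq_analyticRank_of_analyticRank_le_one) (hnf : exists_isNewformOf)
    (hMilneC : Milne1972.bsdQuotient_baseChange_quadratic_anyModel) (hBF : bsdTriple_of_hasCM_of_L_one_ne_zero)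
    (W : WeierstrassCurve ℚ) [W.IsElliptic] [W.IsGloballyMinimal] [NeZero (W.conductorNorm ℤ)]
    (hCM : W.HasCM) (hin : Rank1Residual.CMInert W 2) (hρ2 : W.HasSurjectiveModNGaloisRep 2) (hr : W.analyticRank = 1)
    (hT : Odd W.tamagawaProduct) (K : Type) [Field K] [NumberField K] (hIQ : IsImaginaryQuadratic K)
    (hodd : Odd (NumberField.discr K)) (h3 : NumberField.discr K ≠ -3) (hHe : SatisfiesHeegnerHypothesis (W.conductorNorm ℤ) K)
    (hdef : ∑ q ∈ (NumberField.discr K).natAbs.primeFactors,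
        ((if jacobiSym W.Δ.num q = -1 then 1 else 0) +
          (if jacobiSym W.Δ.num q = 1 ∧ Even (W.frobeniusTrace q) then 2 else 0)) ≤ 1)
    (h37 : prop37_2_reductionCongruence_inert (W.conductorNorm ℤ) W K)
    (Dt : ModularParametrizationData W (W.conductorNorm ℤ))
    (hopt : ∀ z ∈ Dt.L.lattice, ∃ w ∈ periodLattice Dt.f, z = (Dt.c : ℂ) * w) (hc : Odd Dt.c)
    (β : ℤ) (ι : K →+* ℂ) (d₁ : KolyvaginHeegnerData Dt β ι 1) (hy : ¬ IsOfFinAddOrder d₁.derivedPoint) (M₀ : ℕ)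
    (hM₀ : ∃ Q : (W.baseChange (ringClassField K ι 1)).toAffine.Point, ((2 ^ M₀ : ℕ) : ℤ) • Q = d₁.derivedPoint)
    (hndiv : ¬ ∃ Q : (W.baseChange (ringClassField K ι 1)).toAffine.Point, ((2 ^ (M₀ + 1) : ℕ) : ℤ) • Q = d₁.derivedPoint)
    {n : ℕ} (d : KolyvaginHeegnerData Dt β ι n) (hn : Squarefree n)
    (hKoly : ∀ ℓ ∈ n.primeFactors, Zhang2014.IsKolyvaginPrime (W.conductorNorm ℤ) W K 2 ℓ ∧ Rank1Residual.CMInert W ℓ)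
    (hPn : ¬ ∃ Q : (W.baseChange (ringClassField K ι n)).toAffine.Point, (2 : ℤ) • Q = d.derivedPoint) :
    BSDp W 2 := by
  have hmod : hasEntireLFunction_rat := hasEntireLFunction_rat_of_exists_isNewformOf hnf
  -- exactness on `Σ ≤ 1` (g21)
  have hsha : Nat.card (AddCommGroup.primaryComponent (W.baseChange K).sha 2) = 2 ^ (2 * M₀) :=
    card_primaryComponent_sha_two_baseChange_eq_pow_of_certificate_of_sum_defect_le_one_of_printedInputs hGZ hGZK hmod hMilneC W hCM hin hρ2 hT
      K hIQ hodd h3 hHe hdef h37 Dt β ι d₁ hy M₀ hM₀ hndiv d hn hKoly hPn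
  -- the twin: `L(E^{(d_K)}, 1) ≠ 0` by Gross–Zagier, a globally minimal CM model of analytic rank `0`, BSD₂ by Burungale–Flach
  obtain ⟨P₀, Hd, hP₀, hP₀K⟩ := exists_heegnerPoint_map_eq_derivedPoint_one hIQ hHe d₁
  have hPinf : ¬ IsOfFinAddOrder P₀ := by
    intro hfin
    apply hy
    rw [← hP₀K]
    exact (WeierstrassCurve.Affine.Point.map (W' := W) (algebraMap K (ringClassField K ι 1)).toRatAlgHom).isOfFinAddOrder hfin
  have hLK : LDerivEK W K ≠ 0 :=
    (lDerivEK_ne_zero_iff_not_isOfFinAddOrder W (W.conductorNorm ℤ) K (hGZ _ W K) hIQ hHe ⟨Dt, Hd, ι, hP₀⟩).mpr hPinf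
  have hL0 : W.entireLFunction 1 = 0 := entireLFunction_one_eq_zero_of_analyticRank_eq_one hr
  have hLt : (W.quadraticTwist (NumberField.discr K : ℚ)).entireLFunction 1 ≠ 0 := by
    intro h0
    apply hLK
    rw [lDerivEK_eq_deriv_mul W K hmod hL0, h0, mul_zero]
  obtain ⟨Wd, _, _, hWd, hcmd, hrd⟩ := CMSupply.exists_minimal_twin_hasCM_analyticRank_zero hnf W hCM K hLt
  have hBd : BSDp Wd 2 := Rank1Residual.bsdp_cm_rankZero (p := 2) hBF hmod hcmd hrd
  -- g0's exact descent
  exact cmExactDescentAtTwo_of_facts hGZ hGZK hmod hMilneC W hCM hin hρ2 hr hT K hIQ hodd h3 hHe Dt hopt hc β ι d₁ hy M₀ hM₀ hndiv hsha Wd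
    hWd hBd

/-- **The certificate-level class theorem with the one-bit condition in Tamagawa currency**: `Σ ≤ 1` replaced by an equation `Wd'` of
the twist `E^{(d_K)}` whose Tamagawa product is not divisible by `4` (`sum_defect_le_one_of_not_four_dvd_tamagawaProduct_twin`).
[cite: Kramer1981, Prop. 3] [cite: McCallumLMS1991, §5 Thm. 5.4] [cite: BurungaleFlach2024, Thm. 1.1 and Cor. 2] -/
theorem bsdp_two_of_certificate_of_twin_tamagawa_of_printedInputs
    (hGZ : ∀ (N : ℕ) [NeZero N] (W : WeierstrassCurve ℚ) (K : Type) [Field K] [NumberField K], gross_zagier N W K)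
    (hGZK : rank_eq_analyticRank_of_analyticRank_le_one) (hnf : exists_isNewformOf)
    (hMilneC : Milne1972.bsdQuotient_baseChange_quadratic_anyModel) (hBF : bsdTriple_of_hasCM_of_L_one_ne_zero)
    (W : WeierstrassCurve ℚ) [W.IsElliptic] [W.IsGloballyMinimal] [NeZero (W.conductorNorm ℤ)]
    (hCM : W.HasCM) (hin : Rank1Residual.CMInert W 2) (hρ2 : W.HasSurjectiveModNGaloisRep 2) (hr : W.analyticRank = 1)
    (hT : Odd W.tamagawaProduct) (K : Type) [Field K] [NumberField K] (hIQ : IsImaginaryQuadratic K)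
    (hodd : Odd (NumberField.discr K)) (h3 : NumberField.discr K ≠ -3) (hHe : SatisfiesHeegnerHypothesis (W.conductorNorm ℤ) K)
    {Wd' : WeierstrassCurve ℚ} [Wd'.IsElliptic] (hWd' : ∃ C : VariableChange ℚ, C • W.quadraticTwist (NumberField.discr K : ℚ) = Wd')
    (h4 : ¬ 4 ∣ Wd'.tamagawaProduct)
    (h37 : prop37_2_reductionCongruence_inert (W.conductorNorm ℤ) W K)
    (Dt : ModularParametrizationData W (W.conductorNorm ℤ))
    (hopt : ∀ z ∈ Dt.L.lattice, ∃ w ∈ periodLattice Dt.f, z = (Dt.c : ℂ) * w) (hc : Odd Dt.c)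
    (β : ℤ) (ι : K →+* ℂ) (d₁ : KolyvaginHeegnerData Dt β ι 1) (hy : ¬ IsOfFinAddOrder d₁.derivedPoint) (M₀ : ℕ)
    (hM₀ : ∃ Q : (W.baseChange (ringClassField K ι 1)).toAffine.Point, ((2 ^ M₀ : ℕ) : ℤ) • Q = d₁.derivedPoint)
    (hndiv : ¬ ∃ Q : (W.baseChange (ringClassField K ι 1)).toAffine.Point, ((2 ^ (M₀ + 1) : ℕ) : ℤ) • Q = d₁.derivedPoint)
    {n : ℕ} (d : KolyvaginHeegnerData Dt β ι n) (hn : Squarefree n)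
    (hKoly : ∀ ℓ ∈ n.primeFactors, Zhang2014.IsKolyvaginPrime (W.conductorNorm ℤ) W K 2 ℓ ∧ Rank1Residual.CMInert W ℓ)
    (hPn : ¬ ∃ Q : (W.baseChange (ringClassField K ι n)).toAffine.Point, (2 : ℤ) • Q = d.derivedPoint) :
    BSDp W 2 :=
  bsdp_two_of_certificate_of_sum_defect_le_one_of_printedInputs hGZ hGZK hnf hMilneC hBF W hCM hin hρ2 hr hT K hIQ hodd h3 hHe
    (sum_defect_le_one_of_not_four_dvd_tamagawaProduct_twin W hT hIQ hodd hHe hWd' h4) h37 Dt hopt hc β ι d₁ hy M₀ hM₀ hndiv d hn hKoly hPn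

/-- **`Σ = 1` — hence `Σ ≤ 1` — on a PRIME Heegner field of a member of H₂**: `|d_K| = q` prime has the single prime factor `q`, and
`(Δ_E / q) = −1` since `Δ_E < 0` on H₂ (`KolyvaginEigenTwo.Δ_neg_of_cmInert_two`) and `q ≡ 3 (mod 4)` (g15's Jacobi argument,
`ShaCountTwo.jacobiSym_num_Δ_eq_neg_one_of_Δ_neg_of_heegner_prime`). [cite: Kramer1981, Prop. 3] -/
theorem sum_defect_le_one_of_prime_of_cmInert_two (W : WeierstrassCurve ℚ) [W.IsElliptic] [W.IsGloballyMinimal]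
    (hCM : W.HasCM) (hin : Rank1Residual.CMInert W 2) (hρ2 : W.HasSurjectiveModNGaloisRep 2)
    (K : Type) [Field K] [NumberField K] (hIQ : IsImaginaryQuadratic K) (hodd : Odd (NumberField.discr K))
    (hHe : SatisfiesHeegnerHypothesis (W.conductorNorm ℤ) K) (hq : (NumberField.discr K).natAbs.Prime) :
    ∑ q ∈ (NumberField.discr K).natAbs.primeFactors,
        ((if jacobiSym W.Δ.num q = -1 then 1 else 0) +
          (if jacobiSym W.Δ.num q = 1 ∧ Even (W.frobeniusTrace q) then 2 else 0)) ≤ 1 := by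
  have hΔ : W.Δ < 0 := KolyvaginEigenTwo.Δ_neg_of_cmInert_two W hCM hin hρ2
  have hjac : jacobiSym W.Δ.num (NumberField.discr K).natAbs = -1 :=
    ShaCountTwo.jacobiSym_num_Δ_eq_neg_one_of_Δ_neg_of_heegner_prime W K hIQ hodd hHe hq hΔ
  have hne : ¬ (jacobiSym W.Δ.num (NumberField.discr K).natAbs = 1 ∧ Even (W.frobeniusTrace (NumberField.discr K).natAbs)) := by
    rintro ⟨h1, -⟩
    rw [hjac] at h1
    norm_num at h1
  rw [Nat.Prime.primeFactors hq, Finset.sum_singleton, if_pos hjac, if_neg hne]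

/-- **The certificate-level class theorem on a PRIME Heegner field** (`|d_K|` prime ⟹ `Σ = 1`): g19's habitat, every exponent `M₀`.
[cite: McCallumLMS1991, §5 Thm. 5.4] [cite: GrossZagier1986, V.§2] [cite: BurungaleFlach2024, Thm. 1.1 and Cor. 2]
[cite: GrossLMS1991, Prop. 3.7 (2)] -/
theorem bsdp_two_of_certificate_of_prime_of_printedInputs
    (hGZ : ∀ (N : ℕ) [NeZero N] (W : WeierstrassCurve ℚ) (K : Type) [Field K] [NumberField K], gross_zagier N W K)
    (hGZK : rank_eq_analyticRank_of_analyticRank_le_one) (hnf : exists_isNewformOf)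
    (hMilneC : Milne1972.bsdQuotient_baseChange_quadratic_anyModel) (hBF : bsdTriple_of_hasCM_of_L_one_ne_zero)
    (W : WeierstrassCurve ℚ) [W.IsElliptic] [W.IsGloballyMinimal] [NeZero (W.conductorNorm ℤ)]
    (hCM : W.HasCM) (hin : Rank1Residual.CMInert W 2) (hρ2 : W.HasSurjectiveModNGaloisRep 2) (hr : W.analyticRank = 1)
    (hT : Odd W.tamagawaProduct) (K : Type) [Field K] [NumberField K] (hIQ : IsImaginaryQuadratic K)
    (hodd : Odd (NumberField.discr K)) (h3 : NumberField.discr K ≠ -3) (hq : (NumberField.discr K).natAbs.Prime)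
    (hHe : SatisfiesHeegnerHypothesis (W.conductorNorm ℤ) K)
    (h37 : prop37_2_reductionCongruence_inert (W.conductorNorm ℤ) W K)
    (Dt : ModularParametrizationData W (W.conductorNorm ℤ))
    (hopt : ∀ z ∈ Dt.L.lattice, ∃ w ∈ periodLattice Dt.f, z = (Dt.c : ℂ) * w) (hc : Odd Dt.c)
    (β : ℤ) (ι : K →+* ℂ) (d₁ : KolyvaginHeegnerData Dt β ι 1) (hy : ¬ IsOfFinAddOrder d₁.derivedPoint) (M₀ : ℕ)
    (hM₀ : ∃ Q : (W.baseChange (ringClassField K ι 1)).toAffine.Point, ((2 ^ M₀ : ℕ) : ℤ) • Q = d₁.derivedPoint)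
    (hndiv : ¬ ∃ Q : (W.baseChange (ringClassField K ι 1)).toAffine.Point, ((2 ^ (M₀ + 1) : ℕ) : ℤ) • Q = d₁.derivedPoint)
    {n : ℕ} (d : KolyvaginHeegnerData Dt β ι n) (hn : Squarefree n)
    (hKoly : ∀ ℓ ∈ n.primeFactors, Zhang2014.IsKolyvaginPrime (W.conductorNorm ℤ) W K 2 ℓ ∧ Rank1Residual.CMInert W ℓ)
    (hPn : ¬ ∃ Q : (W.baseChange (ringClassField K ι n)).toAffine.Point, (2 : ℤ) • Q = d.derivedPoint) :
    BSDp W 2 :=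
  bsdp_two_of_certificate_of_sum_defect_le_one_of_printedInputs hGZ hGZK hnf hMilneC hBF W hCM hin hρ2 hr hT K hIQ hodd h3 hHe
    (sum_defect_le_one_of_prime_of_cmInert_two W hCM hin hρ2 K hIQ hodd hHe hq) h37 Dt hopt hc β ι d₁ hy M₀ hM₀ hndiv d hn hKoly hPn

/-! ## §2 From the mere existence of a primitive class (no exponent binders) -/

/-- **THE BOOKABLE SHAPE: `BSD₂(E)` for `E ∈ H₂` whose Kolyvagin system over a one-bit Heegner field is `2`-primitive at some level.**
As in §1 but with the exponent binders `M₀`, `hM₀`, `hndiv` REMOVED: `y_K = P(1)` of infinite order and the EXISTENCE of a certificate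
(`n` square-free of CM-inert Zhang–Kolyvagin primes at `2`, a datum `d`, `P(n) ∉ 2E(K[n])`) suffice — the exact `2`-divisibility exponent
of `y_K` in the finitely generated group `E(K[1])` exists (Mordell–Weil over the number field `K[1]`,
`exists_pow_smul_eq_and_not_of_not_isOfFinAddOrder`).  Modulo the six prints; BSD is NOT proved by this.
[cite: McCallumLMS1991, §5 Lemma 5.1, Thm. 5.4] [cite: GrossZagier1986, V.§2] [cite: BurungaleFlach2024, Thm. 1.1 and Cor. 2]
[cite: GrossLMS1991, Prop. 3.7 (2)] -/
theorem bsdp_two_of_exists_certificate_of_sum_defect_le_one_of_printedInputs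
    (hGZ : ∀ (N : ℕ) [NeZero N] (W : WeierstrassCurve ℚ) (K : Type) [Field K] [NumberField K], gross_zagier N W K)
    (hGZK : rank_eq_analyticRank_of_analyticRank_le_one) (hnf : exists_isNewformOf)
    (hMilneC : Milne1972.bsdQuotient_baseChange_quadratic_anyModel) (hBF : bsdTriple_of_hasCM_of_L_one_ne_zero)
    (W : WeierstrassCurve ℚ) [W.IsElliptic] [W.IsGloballyMinimal] [NeZero (W.conductorNorm ℤ)]
    (hCM : W.HasCM) (hin : Rank1Residual.CMInert W 2) (hρ2 : W.HasSurjectiveModNGaloisRep 2) (hr : W.analyticRank = 1)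
    (hT : Odd W.tamagawaProduct) (K : Type) [Field K] [NumberField K] (hIQ : IsImaginaryQuadratic K)
    (hodd : Odd (NumberField.discr K)) (h3 : NumberField.discr K ≠ -3) (hHe : SatisfiesHeegnerHypothesis (W.conductorNorm ℤ) K)
    (hdef : ∑ q ∈ (NumberField.discr K).natAbs.primeFactors,
        ((if jacobiSym W.Δ.num q = -1 then 1 else 0) +
          (if jacobiSym W.Δ.num q = 1 ∧ Even (W.frobeniusTrace q) then 2 else 0)) ≤ 1)
    (h37 : prop37_2_reductionCongruence_inert (W.conductorNorm ℤ) W K)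
    (Dt : ModularParametrizationData W (W.conductorNorm ℤ))
    (hopt : ∀ z ∈ Dt.L.lattice, ∃ w ∈ periodLattice Dt.f, z = (Dt.c : ℂ) * w) (hc : Odd Dt.c)
    (β : ℤ) (ι : K →+* ℂ) (d₁ : KolyvaginHeegnerData Dt β ι 1) (hy : ¬ IsOfFinAddOrder d₁.derivedPoint)
    (hcert : ∃ (n : ℕ) (d : KolyvaginHeegnerData Dt β ι n), Squarefree n ∧
      (∀ ℓ ∈ n.primeFactors, Zhang2014.IsKolyvaginPrime (W.conductorNorm ℤ) W K 2 ℓ ∧ Rank1Residual.CMInert W ℓ) ∧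
      ¬ ∃ Q : (W.baseChange (ringClassField K ι n)).toAffine.Point, (2 : ℤ) • Q = d.derivedPoint) :
    BSDp W 2 := by
  obtain ⟨n, d, hn, hKoly, hPn⟩ := hcert
  -- the exact exponent `M₀` (Mordell–Weil over the number field `K[1]`)
  haveI : NumberField (ringClassField K ι 1) := numberField_ringClassField hIQ ι one_ne_zero
  haveI : (W.baseChange (ringClassField K ι 1)).IsElliptic := by rw [baseChange]; infer_instance
  haveI : Module.Finite ℤ (W.baseChange (ringClassField K ι 1)).toAffine.Point := by
    convert (W.baseChange (ringClassField K ι 1)).module_finite_point_holds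
  obtain ⟨M₀, hM₀, hndiv⟩ := exists_pow_smul_eq_and_not_of_not_isOfFinAddOrder Nat.prime_two hy
  exact bsdp_two_of_certificate_of_sum_defect_le_one_of_printedInputs hGZ hGZK hnf hMilneC hBF W hCM hin hρ2 hr hT K hIQ hodd h3 hHe hdef
    h37 Dt hopt hc β ι d₁ hy M₀ hM₀ hndiv d hn hKoly hPn

/-! ## §3 From the route's conjecture crux 24648 and a one-bit Heegner twist -/

/-- **`BSD₂(E)` FROM KOLYVAGIN'S CONJECTURE AT `2` (crux 24648, by name) AND ONE ONE-BIT HEEGNER FIELD WITH `L(E^{(d_K)},1) ≠ 0`.**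
`W ∈ H₂` with an optimal parametrisation `Dt` of odd Manin constant; `K` imaginary quadratic with odd `d_K ≠ −3`, Heegner for `N_E`,
`Σ ≤ 1`, and `L(E^{(d_K)}, 1) ≠ 0`.  The frame is built as in `CMSupply.cmPrimitiveSupplyAtInertTwo_of_kolyvaginConjectureAtTwo`
(`β` from the Heegner condition, a level-`1` datum from Darmon's Thm. 3.6, any `ι`); `y_K` has infinite order by Gross–Zagier
(`CMSupply.not_isOfFinAddOrder_derivedPoint_one_of_rankOne`); crux 24648 supplies the certificate; §2 concludes.  Modulo the six
prints; BSD is NOT proved by this. [cite: WZhang2014, Thm. 1.1] [cite: GrossLMS1991, §11 and Prop. 3.7 (2)] [cite: GrossZagier1986, I.6.3]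
[cite: Darmon2004, Thm. 3.6] [cite: BurungaleFlach2024, Thm. 1.1 and Cor. 2] -/
theorem bsdp_two_of_kolyvaginConjecture_of_oneBit_twist_of_printedInputs
    (hGZ : ∀ (N : ℕ) [NeZero N] (W : WeierstrassCurve ℚ) (K : Type) [Field K] [NumberField K], gross_zagier N W K)
    (hGZK : rank_eq_analyticRank_of_analyticRank_le_one) (hnf : exists_isNewformOf)
    (hMilneC : Milne1972.bsdQuotient_baseChange_quadratic_anyModel) (hBF : bsdTriple_of_hasCM_of_L_one_ne_zero)
    (hKC : CMKolyvaginConjectureAtInertTwo)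
    (W : WeierstrassCurve ℚ) [W.IsElliptic] [W.IsGloballyMinimal] [NeZero (W.conductorNorm ℤ)]
    (hCM : W.HasCM) (hin : Rank1Residual.CMInert W 2) (hρ2 : W.HasSurjectiveModNGaloisRep 2) (hr : W.analyticRank = 1)
    (hT : Odd W.tamagawaProduct) (Dt : ModularParametrizationData W (W.conductorNorm ℤ))
    (hopt : ∀ z ∈ Dt.L.lattice, ∃ w ∈ periodLattice Dt.f, z = (Dt.c : ℂ) * w) (hc : Odd Dt.c)
    (K : Type) [Field K] [NumberField K] (hIQ : IsImaginaryQuadratic K)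
    (hodd : Odd (NumberField.discr K)) (h3 : NumberField.discr K ≠ -3) (hHe : SatisfiesHeegnerHypothesis (W.conductorNorm ℤ) K)
    (hdef : ∑ q ∈ (NumberField.discr K).natAbs.primeFactors,
        ((if jacobiSym W.Δ.num q = -1 then 1 else 0) +
          (if jacobiSym W.Δ.num q = 1 ∧ Even (W.frobeniusTrace q) then 2 else 0)) ≤ 1)
    (hL : (W.quadraticTwist (NumberField.discr K : ℚ)).entireLFunction 1 ≠ 0)
    (h37 : prop37_2_reductionCongruence_inert (W.conductorNorm ℤ) W K) :
    BSDp W 2 := by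
  -- the frame `(β, ι, d₁)`
  obtain ⟨β, hβ⟩ := exists_dvd_sq_sub_discr_holds (W.conductorNorm ℤ) K hIQ hHe
  let ι : K →+* ℂ := Classical.choice inferInstance
  obtain ⟨d₁⟩ := exists_kolyvaginHeegnerData_one
    (phi_heegnerTau_mem_singularModuliField_holds (W.conductorNorm ℤ) W K) hIQ Dt β ι hβ
  -- `y_K` of infinite order (Gross–Zagier + modularity)
  have hy : ¬ IsOfFinAddOrder d₁.derivedPoint :=
    CMSupply.not_isOfFinAddOrder_derivedPoint_one_of_rankOne hnf W K (hGZ _ W K) hIQ hHe hr hL d₁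
  -- Kolyvagin's conjecture at `2` (crux 24648) supplies the certificate
  have hcert := hKC W hCM hin hρ2 hr hT K hIQ hodd h3 hHe Dt hopt hc β ι d₁ hy
  exact bsdp_two_of_exists_certificate_of_sum_defect_le_one_of_printedInputs hGZ hGZK hnf hMilneC hBF W hCM hin hρ2 hr hT K hIQ hodd h3
    hHe hdef h37 Dt hopt hc β ι d₁ hy hcert

/-- **THE HABITAT CONCLUSION OF `closes` FROM 24648 + A ONE-BIT TWIST SUPPLY + PRINTS.**  Hypotheses: the five BSD-side prints, Gross
1991 Prop. 3.7 (2) for every `(W, K)`, the route's conjecture crux `CMKolyvaginConjectureAtInertTwo` (24648), and a ONE-BIT TWIST SUPPLY: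
every `W ∈ H₂` (with an optimal odd-Manin parametrisation) has an imaginary quadratic `K` with odd `d_K ≠ −3`, Heegner for `N_E`, genus
defect `Σ ≤ 1` and `L(E^{(d_K)}, 1) ≠ 0`.  Conclusion: `BSDp W 2` for every `W ∈ H₂` with an optimal odd-Manin parametrisation — the
habitat branch of the route's deciding theorem, with the supply crux 24276, the exactness crux 24277 and the descent 22837 no longer
appearing (24277 is a theorem on `Σ ≤ 1` mod prints, 22837 is a theorem mod prints).  Hoffstein–Luo's twist gives no control of `Σ`; a
supply with `Σ = 1` (e.g. prime `|d_K|`) is Silverman-type non-vanishing, open in print for the class.  BSD is NOT proved by this; no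
item is closed by this file. [cite: WZhang2014, Thm. 1.1] [cite: GrossLMS1991, §11 and Prop. 3.7 (2)] [cite: GrossZagier1986, I.6.3]
[cite: BurungaleFlach2024, Thm. 1.1 and Cor. 2] [cite: Milne1972ArithmeticAV, Thm. 1] -/
theorem bsdp_two_onHabitat_of_kolyvaginConjecture_of_oneBitSupply_of_printedInputs
    (hGZ : ∀ (N : ℕ) [NeZero N] (W : WeierstrassCurve ℚ) (K : Type) [Field K] [NumberField K], gross_zagier N W K)
    (hGZK : rank_eq_analyticRank_of_analyticRank_le_one) (hnf : exists_isNewformOf)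
    (hMilneC : Milne1972.bsdQuotient_baseChange_quadratic_anyModel) (hBF : bsdTriple_of_hasCM_of_L_one_ne_zero)
    (h37 : ∀ (W : WeierstrassCurve ℚ) [W.IsGloballyMinimal] [NeZero (W.conductorNorm ℤ)] (K : Type) [Field K] [NumberField K],
      prop37_2_reductionCongruence_inert (W.conductorNorm ℤ) W K)
    (hKC : CMKolyvaginConjectureAtInertTwo)
    (hSup : ∀ (W : WeierstrassCurve ℚ) [W.IsElliptic] [W.IsGloballyMinimal] [NeZero (W.conductorNorm ℤ)],
      W.HasCM → Rank1Residual.CMInert W 2 → W.HasSurjectiveModNGaloisRep (2 : ℤ) → W.analyticRank = 1 → Odd W.tamagawaProduct →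
      ∃ (K : Type) (_ : Field K) (_ : NumberField K), IsImaginaryQuadratic K ∧ Odd (NumberField.discr K) ∧
        NumberField.discr K ≠ -3 ∧ SatisfiesHeegnerHypothesis (W.conductorNorm ℤ) K ∧
        (∑ q ∈ (NumberField.discr K).natAbs.primeFactors,
          ((if jacobiSym W.Δ.num q = -1 then 1 else 0) +
            (if jacobiSym W.Δ.num q = 1 ∧ Even (W.frobeniusTrace q) then 2 else 0)) ≤ 1) ∧
        (W.quadraticTwist (NumberField.discr K : ℚ)).entireLFunction 1 ≠ 0)
    (W : WeierstrassCurve ℚ) [W.IsElliptic] [W.IsGloballyMinimal] [NeZero (W.conductorNorm ℤ)]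
    (hCM : W.HasCM) (hin : Rank1Residual.CMInert W 2) (hρ2 : W.HasSurjectiveModNGaloisRep 2) (hr : W.analyticRank = 1)
    (hT : Odd W.tamagawaProduct)
    (hfr : ∃ Dt : ModularParametrizationData W (W.conductorNorm ℤ),
      (∀ z ∈ Dt.L.lattice, ∃ w ∈ periodLattice Dt.f, z = (Dt.c : ℂ) * w) ∧ Odd Dt.c) :
    BSDp W 2 := by
  obtain ⟨Dt, hopt, hc⟩ := hfr
  obtain ⟨K, _, _, hIQ, hodd, h3, hHe, hdef, hL⟩ := hSup W hCM hin hρ2 hr hT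
  exact bsdp_two_of_kolyvaginConjecture_of_oneBit_twist_of_printedInputs hGZ hGZK hnf hMilneC hBF hKC W hCM hin hρ2 hr hT Dt hopt hc K hIQ
    hodd h3 hHe hdef hL (h37 W K)

end Summit.BirchSwinnertonDyer.BirchSwinnertonDyer.Theorems.KolyvaginLowerTwo

end
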